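import Mathlib.Geometry.Manifold.ContMDiff.Atlas
import Mathlib.Geometry.Manifold.ContMDiff.NormedSpace
import Mathlib.Geometry.Manifold.ContMDiff.Constructions
import Mathlib.Geometry.Manifold.VectorBundle.Tangent
import Mathlib.Geometry.Manifold.PartitionOfUnity
import HarnessLib

/-!
# A tube map along a smooth map with prescribed fibre derivative (exponential substitute)

Topic `Literature/Topology/FourManifolds`; infrastructure for the named fact
`Literature.Topology.FourManifolds.nonempty_circleNbhd` of `Literature.Topology.FourManifolds.CircleSurgery` (tubular
neighbourhoods of smoothly embedded circles in orientable 4-manifolds; item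
`provefact-Literature.nonempty_circleNbhd`), first file of its decomposition. Everything here is proved;
no named facts are introduced.

The classical existence proof of tubular neighbourhoods (Kosinski, *Differential Manifolds*
(1993), III, Thm. 2.2: restrict the exponential map of a Riemannian metric to the normal bundle;
its differential along the zero section is the identity on fibres, Lemma 1.4, so it is an
embedding near the zero section) needs a smooth map defined near the zero section of the normal
bundle, restricting to the inclusion on the zero section, with prescribed (invertible) fibre
derivative there. Mathlib has no Riemannian exponential map; this file constructs such a map
*along a single smooth map* `c : M → X` from a compact manifold, for any prescribed smooth field
`N x : F →L[ℝ] T_{c x} X` of linear maps into the tangent spaces, by finitely many **chart moves**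
glued with a partition of unity on `M` (no convexity is needed in `X`: the moves are composed, not
averaged):

* `Literature.frameIn c N p x` — the field read in the preferred chart at `p : X`
  (`tangentCoordChange (c x) p (c x) ∘ N x`); `Literature.IsSmoothAlong IM c N` — smoothness of the field
  along `c` (every chart reading is `C^∞` on `c ⁻¹' (chart domain)`), the chart form of smoothness
  of a section of `Hom(F, c^*TX)`; the cocycle rule `tangentCoordChange_comp_frameIn`.
* `Literature.tubeStep c N p β g (x, v) = φ_p⁻¹ (φ_p (g (x, v)) + β x • frameIn c N p x v)` (one move in
  the extended chart `φ_p` at `p`, not moving points outside the chart domain) and the iteration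
  `Literature.Topology.FourManifolds.tubeList` over a list of chart centres and weights, starting from `(x, v) ↦ c x`.
* The invariant (`Literature.Topology.FourManifolds.SmoothNearZero`, `tubeStep_zero`, `SmoothNearZero.step`,
  `hasFDerivAt_tubeStep`, `tubeList_spec`): the iterate is `C^∞` on an open neighbourhood of the
  zero section, restricts to `c` on it, and its fibre derivative at `(x, 0)` read in any chart
  containing `c x` is `(∑ βᵢ x) • (N x read in that chart)` — flat calculus in the fibre `F` only,
  the chart changes entering through their derivative cocycle `tangentCoordChange`.
* `Literature.Topology.FourManifolds.exists_tube_of_isSmoothAlong` — for `M` compact Hausdorff: a map `G : M × F → X`, smooth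
  near the zero section, `G (x, 0) = c x`, with fibre derivative `N x` at `(x, 0)` (chart centres
  from a finite subcover of `c ⁻¹'(chart domains)`, weights from
  `SmoothPartitionOfUnity.exists_isSubordinate`).

The sequel `CircleNbhdOfFraming.lean` combines this with the inverse function theorem on
manifolds to turn a normal framing of an embedded circle into a tubular neighbourhood.

## References

* A. A. Kosinski, *Differential Manifolds*, Pure Appl. Math. 138, Academic Press (1993), Ch. III,
  §1 Thm. 1.2, Lemma 1.4 (exponential map and its differential along the zero section), §2
  Thm. 2.2, Cor. 2.3 (tubular neighbourhoods). [Kosinski1993]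
* M. W. Hirsch, *Differential Topology*, GTM 33 (1976), Ch. 4, §5–6. [HirschDT1976]

## Design notes

* The target manifold `X` is charted on its model vector space `E` with the trivial model
  `𝓘(ℝ, E)` (the case of `ChartedSpace (EuclideanSpace ℝ (Fin 4)) X`, model `𝓡 4`), so that
  extended charts are the charts and `range 𝓘(ℝ, E) = univ`.
* Junk values: `tubeStep` does not move points outside the chart domain and `G` is arbitrary far
  from the zero section; only `SmoothNearZero` (smoothness on *some* open neighbourhood of the
  zero section) is asserted.
-/

open scoped Manifold ContDiff Topology
open Set Function Filter

noncomputable section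

namespace Literature.Topology.FourManifolds

section FrameIn

variable {M : Type*} {E : Type*} [NormedAddCommGroup E] [NormedSpace ℝ E] {X : Type*}
  [TopologicalSpace X] [ChartedSpace E X] [IsManifold 𝓘(ℝ, E) ∞ X]
  {F : Type*} [NormedAddCommGroup F] [NormedSpace ℝ F] {ι : Type*}

/-- **A field of linear maps into the tangent spaces along a map, read in a chart.** For a map
`c : M → X` into a manifold charted on the vector space `E` and a family `N x : F →L[ℝ] E` of linear
maps into the tangent spaces `T_{c x} X = E` (read, as Mathlib's tangent spaces are, in the
preferred chart at `c x`), `frameIn c N p x` is `N x` read in the preferred chart at `p`: the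
composite with the derivative `tangentCoordChange 𝓘(ℝ, E) (c x) p (c x)` of the chart change.
Meaningful when `c x` lies in the chart domain of `p`. [folklore] -/
def frameIn (c : M → X) (N : M → F →L[ℝ] E) (p : X) (x : M) : F →L[ℝ] E :=
  (tangentCoordChange 𝓘(ℝ, E) (c x) p (c x)).comp (N x)

/-- Unfolding of `frameIn`. [folklore] -/
theorem frameIn_apply (c : M → X) (N : M → F →L[ℝ] E) (p : X) (x : M) (v : F) :
    frameIn c N p x v = tangentCoordChange 𝓘(ℝ, E) (c x) p (c x) (N x v) := rfl

/-- Read in the chart at `c x` itself, the field is `N x`. [folklore] -/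
theorem frameIn_self (c : M → X) (N : M → F →L[ℝ] E) (x : M) : frameIn c N (c x) x = N x := by
  ext v
  rw [frameIn_apply, tangentCoordChange_self (mem_extChartAt_source (c x))]

/-- Cocycle rule: reading in the chart at `q` and then changing to the chart at `p` is reading in
the chart at `p`. [folklore] -/
theorem tangentCoordChange_comp_frameIn {c : M → X} (N : M → F →L[ℝ] E) {p q : X} {x : M}
    (hq : c x ∈ (chartAt E q).source) (hp : c x ∈ (chartAt E p).source) :
    (tangentCoordChange 𝓘(ℝ, E) q p (c x)).comp (frameIn c N q x) = frameIn c N p x := by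
  ext v
  simp only [ContinuousLinearMap.coe_comp, comp_apply, frameIn_apply]
  exact tangentCoordChange_comp ⟨⟨mem_extChartAt_source (c x), by rwa [extChartAt_source]⟩,
    by rwa [extChartAt_source]⟩

/-! ### One chart move -/

open Classical in
/-- **One chart move.** Given the current tube map `g : M × F → X`, a chart centre `p : X`, a
weight function `β : M → ℝ` and the field `N`, move the point `g (x, v)` inside the chart at `p`
by the vector `β x • frameIn c N p x v`; points outside the chart domain are not moved (they only
occur where `β` vanishes, in the application). [folklore] -/
def tubeStep (c : M → X) (N : M → F →L[ℝ] E) (p : X) (β : M → ℝ) (g : M × F → X) (q : M × F) :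
    X :=
  if g q ∈ (chartAt E p).source then
    (extChartAt 𝓘(ℝ, E) p).symm (extChartAt 𝓘(ℝ, E) p (g q) + β q.1 • frameIn c N p q.1 q.2)
  else g q

/-- The iterated chart moves along a list of (chart centre, weight) pairs, starting from the
"zero tube" `(x, v) ↦ c x`. [folklore] -/
def tubeList (c : M → X) (N : M → F →L[ℝ] E) (p : ι → X) (β : ι → M → ℝ) :
    List ι → M × F → X
  | [] => fun q => c q.1
  | i :: l => tubeStep c N (p i) (β i) (tubeList c N p β l)

variable {c : M → X} {N : M → F →L[ℝ] E}

/-- A chart move does not move the zero section. [folklore] -/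
theorem tubeStep_zero (p : X) (β : M → ℝ) {g : M × F → X} (hg : ∀ x, g (x, 0) = c x) (x : M) :
    tubeStep c N p β g (x, 0) = c x := by
  unfold tubeStep
  split_ifs with h
  · rw [map_zero, smul_zero, add_zero, hg]
    rw [hg] at h
    exact (extChartAt 𝓘(ℝ, E) p).left_inv (by rwa [extChartAt_source])
  · exact hg x

/-- Where the weight vanishes, a chart move does not move anything. [folklore] -/
theorem tubeStep_of_eq_zero (p : X) {β : M → ℝ} (g : M × F → X) {q : M × F} (hβ : β q.1 = 0) :
    tubeStep c N p β g q = g q := by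
  unfold tubeStep
  split_ifs with h
  · rw [hβ, zero_smul, add_zero]
    exact (extChartAt 𝓘(ℝ, E) p).left_inv (by rwa [extChartAt_source])
  · rfl

/-- **The fibre derivative after a chart move.** Fix `x : M`. If `v ↦ g (x, v)` is continuous at
`0` with `g (x, 0) = c x`, and for every chart containing `c x` the map `v ↦ g (x, v)` read in that
chart has derivative `s • (N x read in the chart)` at `0`, then after the chart move with weight `β`
(supported in the chart domain of `p`) the derivative read in any chart containing `c x` is
`(s + β x) • (N x read in the chart)`: the chain rule through the chart change, whose derivative
is the cocycle `tangentCoordChange`. [folklore] -/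
theorem hasFDerivAt_tubeStep {p : X} {β : M → ℝ} {g : M × F → X} {x : M} {s : ℝ}
    (hcont : ContinuousAt (fun v : F => g (x, v)) 0) (hg0 : g (x, 0) = c x)
    (hsub : β x ≠ 0 → c x ∈ (chartAt E p).source)
    (hgd : ∀ q : X, c x ∈ (chartAt E q).source →
      HasFDerivAt (fun v : F => extChartAt 𝓘(ℝ, E) q (g (x, v))) (s • frameIn c N q x) 0)
    {q : X} (hq : c x ∈ (chartAt E q).source) :
    HasFDerivAt (fun v : F => extChartAt 𝓘(ℝ, E) q (tubeStep c N p β g (x, v)))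
      ((s + β x) • frameIn c N q x) 0 := by
  by_cases hβx : β x = 0
  · have : (fun v : F => extChartAt 𝓘(ℝ, E) q (tubeStep c N p β g (x, v))) =
        fun v : F => extChartAt 𝓘(ℝ, E) q (g (x, v)) :=
      funext fun v => by rw [tubeStep_of_eq_zero p g (q := (x, v)) hβx]
    rw [this, hβx, add_zero]
    exact hgd q hq
  have hp : c x ∈ (chartAt E p).source := hsub hβx
  set e := extChartAt 𝓘(ℝ, E) p with he
  set k : F → E := fun v => e (g (x, v)) + β x • frameIn c N p x v with hk
  have hk0 : k 0 = e (c x) := by simp only [hk, map_zero, smul_zero, add_zero, hg0]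
  have hkd : HasFDerivAt k (s • frameIn c N p x + β x • frameIn c N p x) 0 :=
    (hgd p hp).add ((frameIn c N p x).hasFDerivAt.const_smul (β x))
  -- the chart change and its derivative
  have hT : HasFDerivAt (extChartAt 𝓘(ℝ, E) q ∘ e.symm) (tangentCoordChange 𝓘(ℝ, E) p q (c x))
      (k 0) := by
    rw [hk0]
    have h := hasFDerivWithinAt_tangentCoordChange (I := 𝓘(ℝ, E)) (x := p) (y := q) (z := c x)
      ⟨by rwa [extChartAt_source], by rwa [extChartAt_source]⟩
    rwa [modelWithCornersSelf_coe, range_id, hasFDerivWithinAt_univ] at h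
  have hcomp := hT.comp (0 : F) hkd
  have hL : (tangentCoordChange 𝓘(ℝ, E) p q (c x)).comp
      (s • frameIn c N p x + β x • frameIn c N p x) = (s + β x) • frameIn c N q x := by
    rw [← add_smul, ContinuousLinearMap.comp_smul, tangentCoordChange_comp_frameIn N hp hq]
  rw [hL] at hcomp
  -- near `0` the moved map read in the chart at `q` is this composite
  refine hcomp.congr_of_eventuallyEq ?_
  have hev : ∀ᶠ v in 𝓝 (0 : F), g (x, v) ∈ (chartAt E p).source := by
    refine hcont.preimage_mem_nhds ((chartAt E p).open_source.mem_nhds ?_)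
    show g (x, 0) ∈ (chartAt E p).source
    rwa [hg0]
  filter_upwards [hev] with v hv
  show extChartAt 𝓘(ℝ, E) q (tubeStep c N p β g (x, v)) = (extChartAt 𝓘(ℝ, E) q ∘ e.symm) (k v)
  unfold tubeStep
  rw [if_pos hv]
  rfl

end FrameIn

section General

variable {EM : Type*} [NormedAddCommGroup EM] [NormedSpace ℝ EM] {HM : Type*}
  [TopologicalSpace HM] {IM : ModelWithCorners ℝ EM HM} {M : Type*} [TopologicalSpace M]
  [ChartedSpace HM M]
  {E : Type*} [NormedAddCommGroup E] [NormedSpace ℝ E] {X : Type*} [TopologicalSpace X]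
  [ChartedSpace E X] [IsManifold 𝓘(ℝ, E) ∞ X]
  {F : Type*} [NormedAddCommGroup F] [NormedSpace ℝ F] {ι : Type*}

variable (IM) in
/-- **Smoothness of a field of linear maps along a map.** `IsSmoothAlong IM c N` says that the
family `N x : F →L[ℝ] E` of linear maps into the tangent spaces `T_{c x} X` depends smoothly on
`x ∈ M`: read in the preferred chart at any point `p` (`frameIn c N p`), it is a `C^∞` map into
`F →L[ℝ] E` on the open set `c ⁻¹' (chartAt E p).source` where that reading is meaningful (the
usual smoothness of a section of the vector bundle `Hom(F, c^* TX)`, expressed in the charts of the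
tangent bundle). [folklore] -/
def IsSmoothAlong (c : M → X) (N : M → F →L[ℝ] E) : Prop :=
  ∀ p : X, ContMDiffOn IM 𝓘(ℝ, F →L[ℝ] E) ∞ (frameIn c N p) (c ⁻¹' (chartAt E p).source)

/-! ### The invariant of the iteration -/

variable (IM E) in
/-- A map `g : M × F → X` is **smooth near the zero section** if it is `C^∞` on some open set
containing `M × {0}` (its values far from the zero section are irrelevant). [folklore] -/
def SmoothNearZero (g : M × F → X) : Prop :=
  ∃ W : Set (M × F), IsOpen W ∧ (∀ x, (x, (0 : F)) ∈ W) ∧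
    ContMDiffOn (IM.prod 𝓘(ℝ, F)) 𝓘(ℝ, E) ∞ g W

omit [IsManifold 𝓘(ℝ, E) ∞ X] in
/-- A map which is smooth near the zero section is continuous in the fibre variable at the zero
section. [folklore] -/
theorem SmoothNearZero.continuousAt {g : M × F → X} (hg : SmoothNearZero IM E g) (x : M) :
    ContinuousAt (fun v : F => g (x, v)) 0 := by
  obtain ⟨W, hWo, hW0, hgW⟩ := hg
  have h1 : ContinuousAt g (x, 0) := (hgW.continuousOn.continuousWithinAt (hW0 x)).continuousAt
    (hWo.mem_nhds (hW0 x))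
  exact h1.comp (by fun_prop)

variable {c : M → X} {N : M → F →L[ℝ] E}

/-- **A chart move preserves smoothness near the zero section.** If `g` is smooth near the zero
section and equal to `c` on it, the weight `β` is smooth with `tsupport β ⊆ c ⁻¹' (chart domain)`,
and the field read in the chart is smooth there, then `tubeStep c N p β g` is smooth near the zero
section: near points over `(tsupport β)ᶜ` it equals `g`, and near the other points of the zero
section it is the displayed composite of smooth maps. [folklore] -/
theorem SmoothNearZero.step {p : X} {β : M → ℝ} {g : M × F → X} (hg : SmoothNearZero IM E g)
    (hg0 : ∀ x, g (x, 0) = c x) (hc : Continuous c) (hβ : ContMDiff IM 𝓘(ℝ) ∞ β)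
    (hsub : tsupport β ⊆ c ⁻¹' (chartAt E p).source)
    (hN : ContMDiffOn IM 𝓘(ℝ, F →L[ℝ] E) ∞ (frameIn c N p) (c ⁻¹' (chartAt E p).source)) :
    SmoothNearZero IM E (tubeStep c N p β g) := by
  obtain ⟨W, hWo, hW0, hgW⟩ := hg
  set e := extChartAt 𝓘(ℝ, E) p with he
  set U : Set M := c ⁻¹' (chartAt E p).source with hU
  have hUo : IsOpen U := (chartAt E p).open_source.preimage hc
  -- the displayed composite
  set k : M × F → E := fun q => e (g q) + β q.1 • frameIn c N p q.1 q.2 with hk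
  -- the two open pieces
  set W₁ : Set (M × F) := W ∩ Prod.fst ⁻¹' (tsupport β)ᶜ with hW₁
  set V : Set (M × F) := W ∩ Prod.fst ⁻¹' U with hV
  have hVo : IsOpen V := hWo.inter (hUo.preimage continuous_fst)
  set V' : Set (M × F) := V ∩ g ⁻¹' (chartAt E p).source with hV'
  have hV'o : IsOpen V' :=
    (hgW.continuousOn.mono inter_subset_left).isOpen_inter_preimage hVo (chartAt E p).open_source
  have hkV' : ContMDiffOn (IM.prod 𝓘(ℝ, F)) 𝓘(ℝ, E) ∞ k V' := by
    have h1 : ContMDiffOn (IM.prod 𝓘(ℝ, F)) 𝓘(ℝ, E) ∞ (fun q : M × F => e (g q)) V' :=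
      contMDiffOn_extChartAt.comp (hgW.mono fun q hq => hq.1.1) fun q hq => hq.2
    have h2 : ContMDiffOn (IM.prod 𝓘(ℝ, F)) 𝓘(ℝ) ∞ (fun q : M × F => β q.1) V' :=
      hβ.comp_contMDiffOn (contMDiffOn_fst.mono fun q hq => hq.1.1)
    have h3 : ContMDiffOn (IM.prod 𝓘(ℝ, F)) 𝓘(ℝ, E) ∞ (fun q : M × F => frameIn c N p q.1 q.2)
        V' :=
      (hN.comp contMDiffOn_fst fun q hq => hq.1.2).clm_apply contMDiffOn_snd
    exact h1.add (h2.smul h3)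
  set W₂ : Set (M × F) := V' ∩ k ⁻¹' e.target with hW₂
  have hW₁o : IsOpen W₁ := hWo.inter ((isClosed_tsupport β).isOpen_compl.preimage continuous_fst)
  have hW₂o : IsOpen W₂ :=
    hkV'.continuousOn.isOpen_inter_preimage hV'o (isOpen_extChartAt_target p)
  -- on `W₂` the move is the composite
  have heq₂ : ∀ q ∈ W₂, tubeStep c N p β g q = e.symm (k q) := fun q hq => by
    unfold tubeStep
    rw [if_pos (show g q ∈ (chartAt E p).source from hq.1.2)]
  -- on `W₁` the move is `g`
  have heq₁ : ∀ q ∈ W₁, tubeStep c N p β g q = g q := fun q hq =>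
    tubeStep_of_eq_zero p g (image_eq_zero_of_notMem_tsupport hq.2)
  refine ⟨W₁ ∪ W₂, hW₁o.union hW₂o, fun x => ?_, ?_⟩
  · by_cases hx : x ∈ tsupport β
    · refine Or.inr ⟨⟨⟨hW0 x, hsub hx⟩, ?_⟩, ?_⟩
      · show g (x, 0) ∈ (chartAt E p).source
        rw [hg0]
        exact hsub hx
      · show k (x, 0) ∈ e.target
        simp only [hk, map_zero, smul_zero, add_zero, hg0]
        exact e.map_source (by rw [he, extChartAt_source]; exact hsub hx)
    · exact Or.inl ⟨hW0 x, hx⟩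
  · rintro q (hq | hq)
    · have h1 : ContMDiffAt (IM.prod 𝓘(ℝ, F)) 𝓘(ℝ, E) ∞ g q :=
        hgW.contMDiffAt (hWo.mem_nhds hq.1)
      refine (h1.congr_of_eventuallyEq ?_).contMDiffWithinAt
      exact eventually_of_mem (hW₁o.mem_nhds hq) heq₁
    · have h2 : ContMDiffOn (IM.prod 𝓘(ℝ, F)) 𝓘(ℝ, E) ∞ (e.symm ∘ k) W₂ :=
        (contMDiffOn_extChartAt_symm p).comp (hkV'.mono inter_subset_left) fun q hq => hq.2
      have h3 : ContMDiffAt (IM.prod 𝓘(ℝ, F)) 𝓘(ℝ, E) ∞ (e.symm ∘ k) q :=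
        h2.contMDiffAt (hW₂o.mem_nhds hq)
      refine (h3.congr_of_eventuallyEq ?_).contMDiffWithinAt
      exact eventually_of_mem (hW₂o.mem_nhds hq) heq₂

/-- **The iterated chart moves satisfy the invariant**: smooth near the zero section, equal to
`c` on it, and with fibre derivative at the zero section, read in any chart containing `c x`,
equal to `(∑_{i ∈ l} βᵢ x) • (N x read in the chart)`. [folklore] -/
theorem tubeList_spec (hc : ContMDiff IM 𝓘(ℝ, E) ∞ c) (hN : IsSmoothAlong IM c N) (p : ι → X)
    {β : ι → M → ℝ} (hβ : ∀ i, ContMDiff IM 𝓘(ℝ) ∞ (β i))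
    (hsub : ∀ i, tsupport (β i) ⊆ c ⁻¹' (chartAt E (p i)).source) (l : List ι) :
    SmoothNearZero IM E (tubeList c N p β l) ∧ (∀ x, tubeList c N p β l (x, 0) = c x) ∧
      ∀ (x : M) (q : X), c x ∈ (chartAt E q).source →
        HasFDerivAt (fun v : F => extChartAt 𝓘(ℝ, E) q (tubeList c N p β l (x, v)))
          ((l.map fun i => β i x).sum • frameIn c N q x) 0 := by
  induction l with
  | nil =>
    refine ⟨⟨univ, isOpen_univ, fun _ => mem_univ _, ?_⟩, fun x => rfl, fun x q _ => ?_⟩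
    · exact (hc.comp contMDiff_fst).contMDiffOn
    · simp only [tubeList, List.map_nil, List.sum_nil, zero_smul]
      exact hasFDerivAt_const _ _
  | cons i l ih =>
    obtain ⟨hS, h0, hd⟩ := ih
    refine ⟨hS.step h0 hc.continuous (hβ i) (hsub i) (hN (p i)), fun x => tubeStep_zero _ _ h0 x,
      fun x q hq => ?_⟩
    have := hasFDerivAt_tubeStep (p := p i) (β := β i) (hS.continuousAt x) (h0 x)
      (fun h => hsub i (subset_tsupport _ (Function.mem_support.2 h))) (hd x) hq
    simpa only [tubeList, List.map_cons, List.sum_cons, add_comm (β i x)] using this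

/-! ### Existence of a tube map with prescribed fibre derivative -/

/-- **A smooth map into a manifold extends, along any smooth field of linear maps into the
tangent spaces, to a map of a neighbourhood of the zero section with that field as fibre
derivative.** Let `M` be a compact Hausdorff finite-dimensional `C^∞` manifold, `c : M → X` a
`C^∞` map into a manifold charted on the vector space `E`, and `N x : F →L[ℝ] E` a family of linear
maps into the tangent spaces `T_{c x} X`, smooth along `c` (`IsSmoothAlong`). Then there is a map
`G : M × F → X`, `C^∞` on a neighbourhood of the zero section, with `G (x, 0) = c x`, whose fibre
derivative at `(x, 0)`, read in any chart of `X` containing `c x`, is `N x` read in that chart.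
This is the substitute, along a single map, for the restriction of an exponential map of `X` to
the image of `N` (Kosinski, *Differential Manifolds* (1993), III, Thm. 1.2 and Lemma 1.4: a smooth
`(v, t) ↦ γ_v(t)` on a neighbourhood of the zero section with `γ_v(0) = π(v)`, `γ_v'(0) = v`, and
`D exp = id` on the fibres along the zero section); it is built here without geodesics, by finitely
many chart moves `y ↦ φᵢ⁻¹ (φᵢ y + βᵢ x • Nᵢ x v)` weighted by a partition of unity `(βᵢ)` on `M`
subordinate to the cover `c ⁻¹'(chart domains)` (`tubeList`, `tubeList_spec`). [folklore] -/
theorem exists_tube_of_isSmoothAlong [T2Space M] [CompactSpace M] [FiniteDimensional ℝ EM]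
    [IsManifold IM ∞ M] (hc : ContMDiff IM 𝓘(ℝ, E) ∞ c) (hN : IsSmoothAlong IM c N) :
    ∃ G : M × F → X, SmoothNearZero IM E G ∧ (∀ x, G (x, 0) = c x) ∧
      ∀ (x : M) (q : X), c x ∈ (chartAt E q).source →
        HasFDerivAt (fun v : F => extChartAt 𝓘(ℝ, E) q (G (x, v))) (frameIn c N q x) 0 := by
  -- a finite subcover of the cover of `M` by the preimages of the chart domains
  set U : M → Set M := fun x => c ⁻¹' (chartAt E (c x)).source with hU
  have hUo : ∀ x, IsOpen (U x) := fun x => (chartAt E (c x)).open_source.preimage hc.continuous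
  obtain ⟨t, ht⟩ := isCompact_univ.elim_finite_subcover U hUo fun x _ =>
    mem_iUnion.2 ⟨x, mem_chart_source E (c x)⟩
  -- a smooth partition of unity subordinate to it
  obtain ⟨f, hf⟩ := SmoothPartitionOfUnity.exists_isSubordinate IM isClosed_univ
    (fun i : t => U i) (fun i => hUo i) (fun x hx => by rw [iUnion_subtype]; exact ht hx)
  obtain ⟨hS, h0, hd⟩ := tubeList_spec (F := F) hc hN (fun i : t => c i) (β := fun i => f i)
    (fun i => (f i).contMDiff) hf (Finset.univ : Finset t).toList
  refine ⟨_, hS, h0, fun x q hq => ?_⟩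
  have hsum : ((Finset.univ : Finset t).toList.map fun i => f i x).sum = 1 := by
    rw [Finset.sum_map_toList, ← finsum_eq_sum_of_fintype]
    exact f.sum_eq_one (mem_univ x)
  simpa only [hsum, one_smul] using hd x q hq

end General

end Literature.Topology.FourManifolds
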